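import Summits.QuantumAdvantage.QuantumAdvantage.Theorems.NearExactIsExact.Negative.TwistedTranslation

/-!
# `NearExactIsExact` (stmt-QuantumAdvantage-14043) — negative lemma THEOREM U (gen 40):
  an UNTWISTED `u₅` never realises the flat residual (zero-section parity)

**Context (BQ-11, naff = 5 normal form).** In the last Maiorana–McFarland habitat of
`NearExactIsExact` (biquadratic bijection `π` of `𝔽₂^{11}`, cubics `c₁, c₂`, residual
`c₁ ⊕ c₂∘π = 1_{u = 0}`, DISPROOF.md §10/§24/§43 of the b2b cell) the gen-34/36 normal form over the
`6`-bit frame `u = (ū, u₅)` and the `5`-bit block `t` reads (DISPROOF.md §46.3, §47.8)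
`π(ū,u₅,t) = (ū, x₅, y)`, `x₅ = g(ū) ⊕ u₅(1 ⊕ λ(ū)) ⊕ (Aū)·t`,
`y = B⁰(ū) ⊕ u₅ B¹(ū) ⊕ (M̄(ū) ⊕ u₅E) t`, with `g, B⁰` quadratic and `λ, B¹` affine.

**What this file proves (all `r`, every target length `m`, no computation).** If `λ = 0` and
`B¹` is CONSTANT (`u₅` enters the zero section `t = 0` only through the fixed direction
`v = (e₅, B¹)`), then the zero section alone is contradictory: for every `P : 𝔽₂⁶ → 𝔽₂^m` that does
not depend on the coordinate `u_{i₀}` and has coordinates of degree `≤ 2`, every constant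
`v ∈ 𝔽₂^m` and every cubic `c₂` on `m` bits, `u ↦ c₂(P(u) ⊕ u_{i₀}·v)` has EVEN weight on `𝔽₂⁶`
(`untwisted_section_sum_eq_zero`); but a flat residual forces it to equal `c₁(u,0) ⊕ 1_{u=0}`,
of ODD weight (`untwisted_section_ne_flat`, `untwisted_residual_ne_flat`; the normal-form reading is
`untwisted_normal_form_residual_ne_flat`). So the sub-strata {`naff = 5`, `λ = 0`, `B¹` constant}
of BQ-11 are empty for every block length, whatever `A`, `M̄`, `E` (they only act at `t ≠ 0`)
— DISPROOF.md §47.21. This decides, with no search, the "engine-open" cells of the gen-39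
two-sided census (`LF0 … l0` frames, DISPROOF.md §47.20), whose linear engine had silently dropped
the unmatched top row `u₀⋯u₅` (the coefficient identity `0 = 1` below).

**Proof (Shannon split in `u_{i₀}` + Ax parity).**
`c₂(P u ⊕ u_{i₀} v) = c₂(P u) ⊕ u_{i₀}·(Δ_v c₂)(P u)`. The first summand is invariant under the
fixed-point-free flip `u_{i₀} ↦ u_{i₀} ⊕ 1`, so its weight is even (`sum_eq_zero_of_flip_invariant`);
`Δ_v c₂` has degree `≤ 2` (`stub_derivDegree`), its pull-back along the quadratic `P` degree `≤ 4`
(`fc_isDegLeFun_comp`), so the second summand has degree `≤ 5 < 6` and even weight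
(Ax/McEliece, `sum_ind_eq_zero_of_deg_five`). Equivalently: the coefficient of `u₀u₁⋯u₅` in
`c₂(P u ⊕ u_{i₀} v)` is `0`, in `c₁(u,0) ⊕ 1_{u=0}` it is `1`. Relation to THEOREM TT
(`Negative.TwistedTranslation`): TT allows `B` to depend on `u₅` but needs `M ≡ I` and all
`w`; THEOREM U uses only `w = 0` but needs the `u₅`-slope of the zero section to be constant
(for an affine NON-constant slope `B¹(ū)` the parity argument fails: `u₅·B¹_k(ū)·(…)` reaches
degree `6`; those strata are left to the census).

HONEST FRAMING: the value here is a THEOREM (a kernel-checked negative lemma closing one infinite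
sub-family of the last Maiorana–McFarland habitat of `NearExactIsExact`), NOT summit progress; the crux
and the summit are untouched.
-/

set_option linter.dupNamespace false -- D-0017: single-problem summit ⇒ `QuantumAdvantage.QuantumAdvantage` by design

namespace Summit.QuantumAdvantage.QuantumAdvantage.Theorems.NearExactIsExact.Negative.UntwistedSection

open Finset
open Literature.Computability.QuantumComplexity
open Literature.Computability.QuantumComplexity.BuzetChailloux (bxor)
open Summit.QuantumAdvantage.QuantumAdvantage.Theorems.CubicForrelation.NearExactIsExact
  (fc_isDegLeFun_comp stub_derivDegree te_isDegLeFun_band)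
open Summit.QuantumAdvantage.QuantumAdvantage.Theorems.NearExactIsExact.Negative.SkewProductCore
open Summit.QuantumAdvantage.QuantumAdvantage.Theorems.NearExactIsExact.Negative.SkewProductResidual
  (emb emb_coord_deg)

variable {m r : ℕ}

/-! ### Parity tools on the `6`-bit frame -/

/-- A summand invariant under the fixed-point-free flip `u_{i₀} ↦ u_{i₀} ⊕ 1` has `𝔽₂`-sum `0`
(the orbits are pairs with equal values). [folklore] -/
theorem sum_eq_zero_of_flip_invariant (i₀ : Fin 6) (F : (Fin 6 → Bool) → ZMod 2)
    (hF : ∀ u, F (Function.update u i₀ (!u i₀)) = F u) : ∑ u, F u = 0 := by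
  have h2 : ∀ a : ZMod 2, a + a = 0 := by decide
  refine Finset.sum_involution (fun u _ => Function.update u i₀ (!u i₀)) ?_ ?_ ?_ ?_
  · intro u _
    rw [hF, h2]
  · intro u _ _ h
    have h' := congrFun h i₀
    rw [Function.update_self] at h'
    exact Bool.not_ne_self _ h'
  · intro u _
    exact mem_univ _
  · intro u _
    funext i
    by_cases hi : i = i₀
    · subst hi
      simp
    · rw [Function.update_of_ne hi, Function.update_of_ne hi]

/-- `Σ_u [u = 0] = 1` on the `6`-bit frame. [folklore] -/
theorem sum_ind_delta : ∑ u : Fin 6 → Bool, ind (decide (∀ i, u i = false)) = 1 := by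
  rw [Finset.sum_eq_single (fun _ => false)]
  · simp
  · intro u _ hu
    have hu' : ¬ ∀ i, u i = false := fun h' => hu (funext h')
    simp [hu']
  · intro h'
    exact absurd (mem_univ _) h'

/-! ### THEOREM U -/

/-- **Zero-section parity.** `P : 𝔽₂⁶ → 𝔽₂^m` independent of the coordinate `i₀` with coordinates
of degree `≤ 2`, `v ∈ 𝔽₂^m` constant, `c₂` cubic: `u ↦ c₂(P u ⊕ u_{i₀}·v)` has even weight
(Shannon split `c₂(P u) ⊕ u_{i₀}·(Δ_v c₂)(P u)`: a flip-invariant term plus a term of degree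
`≤ 1 + 2·2 = 5`). [folklore] -/
theorem untwisted_section_sum_eq_zero (i₀ : Fin 6) (P : (Fin 6 → Bool) → (Fin m → Bool))
    (hP : ∀ u b, P (Function.update u i₀ b) = P u) (hPd : ∀ j, IsDegLeFun 2 (fun u => P u j))
    (v : Fin m → Bool) (c₂ : (Fin m → Bool) → Bool) (h₂ : IsDegLeFun 3 c₂) :
    ∑ u, ind (c₂ (bxor (P u) (fun j => u i₀ && v j))) = 0 := by
  have e : ∀ u : Fin 6 → Bool, c₂ (bxor (P u) (fun j => u i₀ && v j)) =
      (c₂ (P u) ^^ (u i₀ && (c₂ (P u) ^^ c₂ (bxor (P u) v)))) := by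
    intro u
    cases h : u i₀
    · have hb : (bxor (P u) fun j => false && v j) = P u := funext fun j => by simp [bxor]
      rw [hb, Bool.false_and, Bool.xor_false]
    · have hb : (bxor (P u) fun j => true && v j) = bxor (P u) v := funext fun j => by simp [bxor]
      rw [hb, Bool.true_and]
      cases c₂ (P u) <;> cases c₂ (bxor (P u) v) <;> rfl
  simp_rw [e, ind_xor]
  rw [sum_add_distrib]
  -- the flip-invariant part
  have h1 : ∑ u, ind (c₂ (P u)) = 0 :=
    sum_eq_zero_of_flip_invariant i₀ _ fun u => by rw [hP]
  -- the derivative part has degree ≤ 5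
  have hD : IsDegLeFun 2 (fun y => c₂ y ^^ c₂ (bxor y v)) := stub_derivDegree m 2 c₂ v h₂
  have h4 : IsDegLeFun 4 (fun u => c₂ (P u) ^^ c₂ (bxor (P u) v)) :=
    fc_isDegLeFun_comp hD P hPd (by norm_num)
  have h5 : IsDegLeFun 5 (fun u : Fin 6 → Bool => u i₀ && (c₂ (P u) ^^ c₂ (bxor (P u) v))) :=
    (te_isDegLeFun_band (isDegLeFun_apply i₀ le_rfl : IsDegLeFun 1 (fun u : Fin 6 → Bool => u i₀)) h4).mono
      (by norm_num)
  rw [h1, sum_ind_eq_zero_of_deg_five h5, add_zero]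

/-- **THEOREM U (zero-section form).** With `P, v, c₂` as above and ANY `a : 𝔽₂⁶ → 𝔽₂` of degree
`≤ 5` (e.g. `a(u) = c₁(u,0)`): `c₂(P u ⊕ u_{i₀}·v) ≠ a(u) ⊕ 1_{u=0}` somewhere — even weight versus
odd weight. [folklore] -/
theorem untwisted_section_ne_flat (i₀ : Fin 6) (P : (Fin 6 → Bool) → (Fin m → Bool))
    (hP : ∀ u b, P (Function.update u i₀ b) = P u) (hPd : ∀ j, IsDegLeFun 2 (fun u => P u j))
    (v : Fin m → Bool) (c₂ : (Fin m → Bool) → Bool) (h₂ : IsDegLeFun 3 c₂)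
    (a : (Fin 6 → Bool) → Bool) (ha : IsDegLeFun 5 a) :
    ¬ ∀ u : Fin 6 → Bool, c₂ (bxor (P u) (fun j => u i₀ && v j)) = (a u ^^ decide (∀ i, u i = false)) := by
  intro h
  have hs := untwisted_section_sum_eq_zero i₀ P hP hPd v c₂ h₂
  simp_rw [h, ind_xor] at hs
  rw [sum_add_distrib, sum_ind_eq_zero_of_deg_five ha, sum_ind_delta, zero_add] at hs
  exact one_ne_zero hs

/-- **THEOREM U (residual form, all `r`).** `Φ : 𝔽₂⁶ × 𝔽₂ʳ → 𝔽₂^{6+r}` ANY map whose zero section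
`u ↦ Φ(u,0)` is `P(u) ⊕ u_{i₀}·v` with `P` independent of `u_{i₀}`, of coordinate degree `≤ 2`, and
`v` constant; `c₁, c₂` cubic. Then the residual `c₁(u,w) ⊕ c₂(Φ(u,w))` is NOT the indicator of the
flat `{u = 0}`. No bijectivity, nothing about `Φ` off the zero section. [folklore] -/
theorem untwisted_residual_ne_flat (i₀ : Fin 6) (P : (Fin 6 → Bool) → (Fin (6 + r) → Bool))
    (hP : ∀ u b, P (Function.update u i₀ b) = P u) (hPd : ∀ j, IsDegLeFun 2 (fun u => P u j))
    (v : Fin (6 + r) → Bool) (Φ : (Fin 6 → Bool) → (Fin r → Bool) → (Fin (6 + r) → Bool))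
    (hΦ : ∀ u, Φ u (fun _ => false) = bxor (P u) (fun j => u i₀ && v j))
    (c₁ c₂ : (Fin (6 + r) → Bool) → Bool) (h₁ : IsDegLeFun 3 c₁) (h₂ : IsDegLeFun 3 c₂) :
    ¬ ∀ (u : Fin 6 → Bool) (w : Fin r → Bool),
      (c₁ (Fin.append u w) ^^ c₂ (Φ u w)) = decide (∀ i, u i = false) := by
  intro h
  have ha : IsDegLeFun 5 (fun u => c₁ (emb r u)) :=
    fc_isDegLeFun_comp h₁ (emb r) (emb_coord_deg r) (by norm_num)
  refine untwisted_section_ne_flat i₀ P hP hPd v c₂ h₂ _ ha fun u => ?_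
  have h' := h u (fun _ => false)
  rw [hΦ] at h'
  exact bool_solve _ _ _ h'

/-- **THEOREM U (normal-form reading, DISPROOF.md §47.21).** Frame coordinate `i₀` ("`u₅`"),
`g` quadratic and `B_k` quadratic, both independent of `u_{i₀}`, `c ∈ 𝔽₂ʳ` constant (`B¹ = c`,
`λ = 0`), and ARBITRARY corrections `X, Y` vanishing on the zero section (`(Aū)·t`,
`(M̄(ū) ⊕ u₅E)t`, or anything else): the map
`(u,w) ↦ (ū, u_{i₀} ⊕ g(u) ⊕ X(u,w), B(u) ⊕ u_{i₀}·c ⊕ Y(u,w))` has residual `≠ 1_{u=0}` against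
every pair of cubics. [folklore] -/
theorem untwisted_normal_form_residual_ne_flat (i₀ : Fin 6)
    (g : (Fin 6 → Bool) → Bool) (hg : ∀ u b, g (Function.update u i₀ b) = g u) (hgd : IsDegLeFun 2 g)
    (B : Fin r → (Fin 6 → Bool) → Bool) (hB : ∀ k u b, B k (Function.update u i₀ b) = B k u)
    (hBd : ∀ k, IsDegLeFun 2 (B k)) (c : Fin r → Bool)
    (X : (Fin 6 → Bool) → (Fin r → Bool) → Bool) (hX : ∀ u, X u (fun _ => false) = false)
    (Y : (Fin 6 → Bool) → (Fin r → Bool) → Fin r → Bool) (hY : ∀ u k, Y u (fun _ => false) k = false)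
    (c₁ c₂ : (Fin (6 + r) → Bool) → Bool) (h₁ : IsDegLeFun 3 c₁) (h₂ : IsDegLeFun 3 c₂) :
    ¬ ∀ (u : Fin 6 → Bool) (w : Fin r → Bool),
      (c₁ (Fin.append u w) ^^ c₂ (Fin.append (Function.update u i₀ ((u i₀ ^^ g u) ^^ X u w))
        (fun k => (B k u ^^ (u i₀ && c k)) ^^ Y u w k))) = decide (∀ i, u i = false) := by
  -- zero section: `P(u) = (ū|_{i₀ ↦ g u}, B u)`, slope `v = (e_{i₀}, c)`
  let P : (Fin 6 → Bool) → (Fin (6 + r) → Bool) :=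
    fun u => Fin.append (Function.update u i₀ (g u)) (fun k => B k u)
  let v : Fin (6 + r) → Bool := Fin.append (fun i : Fin 6 => decide (i = i₀)) c
  have hP : ∀ u b, P (Function.update u i₀ b) = P u := by
    intro u b
    funext j
    induction j using Fin.addCases with
    | left i =>
      simp only [P, Fin.append_left]
      by_cases hi : i = i₀
      · subst hi
        rw [Function.update_self, Function.update_self, hg]
      · rw [Function.update_of_ne hi, Function.update_of_ne hi, Function.update_of_ne hi]
    | right k => simp only [P, Fin.append_right, hB]
  have hPd : ∀ j, IsDegLeFun 2 (fun u => P u j) := by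
    intro j
    induction j using Fin.addCases with
    | left i =>
      by_cases hi : i = i₀
      · subst hi
        have e : (fun u => P u (Fin.castAdd r i)) = g := funext fun u => by
          simp only [P, Fin.append_left, Function.update_self]
        rw [e]; exact hgd
      · have e : (fun u => P u (Fin.castAdd r i)) = fun u => u i := funext fun u => by
          simp only [P, Fin.append_left, Function.update_of_ne hi]
        rw [e]; exact isDegLeFun_apply i (by norm_num)
    | right k =>
      have e : (fun u => P u (Fin.natAdd 6 k)) = B k := funext fun u => by
        simp only [P, Fin.append_right]
      rw [e]; exact hBd k
  refine untwisted_residual_ne_flat i₀ P hP hPd v _ (fun u => ?_) c₁ c₂ h₁ h₂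
  funext j
  induction j using Fin.addCases with
  | left i =>
    simp only [Fin.append_left, bxor, P, v]
    by_cases hi : i = i₀
    · subst hi
      rw [Function.update_self, Function.update_self, hX]
      simp only [decide_true, Bool.and_true, Bool.xor_false]
      cases u i <;> cases g u <;> rfl
    · rw [Function.update_of_ne hi, Function.update_of_ne hi]
      simp [hi]
  | right k =>
    simp only [Fin.append_right, bxor, P, v, hY, Bool.xor_false]

end Summit.QuantumAdvantage.QuantumAdvantage.Theorems.NearExactIsExact.Negative.UntwistedSection
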